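import Summits.KontsevichZagierPeriods.KontsevichZagierPeriods.Theorems.IsometryMove.Negative.Kit

/-!
# `IsometryMove` (stmt-KontsevichZagierPeriods-3471) — negative side II: load-bearing hypotheses

ANY proof of the crux must use `ad − bc ≠ 0` (`isometryMove_false_without_det`: `a = b = c = d = 0`
collapses the unit box onto a null point) and `ε = ±1` (`isometryMove_false_without_eps`; sharper,
`not_isometryMoveAtEps η` for EVERY rational `η ∉ {1, −1}` against the anchor
`isometryMove_iff_atEps : IsometryMove ↔ AtEps 1 ∧ AtEps (−1)` — the `ε`-set is exactly right).
NOT load-bearing for truth (no theorem possible; documented in the crux work file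
`Cruxes/IsometryMove/Disproof.lean` §4): algebraicity of `a, b, c, d` and `r.domain ⊆ {t > 0}`.
[Kontsevich–Zagier 2001, §1.2]
-/

noncomputable section

open MeasureTheory Set MvPolynomial intervalIntegral
open Literature.NumberTheory.Transcendental Literature.ModelTheory.ExponentialFields

namespace Summit.KontsevichZagierPeriods.HyperbolicBloch.IsometryMoveNegative

open Summit.KontsevichZagierPeriods.KontsevichZagierPeriods (Theses.HyperbolicBloch.IsometryMove)

/-! ## §2 Load-bearing hypotheses: `ad − bc ≠ 0` and `ε = ±1`

Each hypothesis `H` of the crux gets `IsometryMoveWithout<H>` (= the family member with `H`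
deleted) and a sorry-free `isometryMove_false_without_<H>`: ANY proof of the crux must use `H`. -/

/-- The crux with the hypothesis `a * d - b * c ≠ 0` DELETED (everything else verbatim). -/
def IsometryMoveWithoutDet : Prop :=
  IsometryMoveGen (fun _ _ _ _ ε => ε = 1 ∨ ε = -1) cruxHeight 3

/-- The crux with the hypothesis `ε = 1 ∨ ε = -1` DELETED (`ε` an arbitrary real). -/
def IsometryMoveWithoutEps : Prop :=
  IsometryMoveGen (fun a b c d _ => a * d - b * c ≠ 0) cruxHeight 3

/-- The crux with `ε = 1 ∨ ε = -1` replaced by `ε = η` for a fixed real `η` (the `η`-slice). [folklore] -/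
def IsometryMoveAtEps (η : ℝ) : Prop :=
  IsometryMoveGen (fun a b c d ε => a * d - b * c ≠ 0 ∧ ε = η) cruxHeight 3

/-- Auxiliary: `isometryMove_imp_withoutDet_of`. [folklore] -/
theorem isometryMove_imp_withoutDet_of (h : IsometryMoveWithoutDet) :
    Theses.HyperbolicBloch.IsometryMove :=
  isometryMove_iff_gen.mpr fun a b c d ε ha hb hc hd hadm => h a b c d ε ha hb hc hd hadm.2

/-- Auxiliary: `isometryMove_imp_withoutEps_of`. [folklore] -/
theorem isometryMove_imp_withoutEps_of (h : IsometryMoveWithoutEps) :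
    Theses.HyperbolicBloch.IsometryMove :=
  isometryMove_iff_gen.mpr fun a b c d ε ha hb hc hd hadm => h a b c d ε ha hb hc hd hadm.1

/-- Auxiliary: `withoutEps_imp_atEps`. [folklore] -/
theorem withoutEps_imp_atEps (h : IsometryMoveWithoutEps) (η : ℝ) : IsometryMoveAtEps η :=
  fun a b c d ε ha hb hc hd hadm => h a b c d ε ha hb hc hd hadm.1

/-- ANCHOR: the crux is exactly the conjunction of its two `ε`-slices. [folklore] -/
theorem isometryMove_iff_atEps :
    Theses.HyperbolicBloch.IsometryMove ↔ (IsometryMoveAtEps 1 ∧ IsometryMoveAtEps (-1)) := by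
  rw [isometryMove_iff_gen]
  constructor
  · intro h
    exact ⟨fun a b c d ε ha hb hc hd hadm => h a b c d ε ha hb hc hd ⟨hadm.1, Or.inl hadm.2⟩,
      fun a b c d ε ha hb hc hd hadm => h a b c d ε ha hb hc hd ⟨hadm.1, Or.inr hadm.2⟩⟩
  · rintro ⟨h1, h2⟩ a b c d ε ha hb hc hd ⟨hdet, hε | hε⟩
    · exact h1 a b c d ε ha hb hc hd ⟨hdet, hε⟩
    · exact h2 a b c d ε ha hb hc hd ⟨hdet, hε⟩

/-- The degenerate point `{0} ⊆ ℝ³` as a (null) representation with density `t⁻³`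
(whose Lean value at `t = 0` is `1/0 = 0`). [folklore] -/
def originRep : KZ.IntegralRep 3 :=
  nullRep 3 (Set.pi univ fun _ => {(0 : ℝ)})
    (isSemialgebraic_pi _ fun i => by simpa using isSemialgebraic_coord_singleton i 0)
    (isSemialgebraicFunOn_powDensity_of_eq_zero
      (isSemialgebraic_pi _ fun i => by simpa using isSemialgebraic_coord_singleton i 0)
      (fun p hp => by simpa using (mem_univ_pi.mp hp) 2) three_ne_zero)
    (volume_pi_eq_zero 0 (by simp))

/-- **`ad − bc ≠ 0` is load-bearing.** Witness `a = b = c = d = 0`, `ε = 1`: then `N = 0` and the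
typed map is `g ≡ 0` (Lean's `x / 0 = 0`), so `g '' σ = {0}` for the unit box `σ`; the transported
representation is null (value `0`) while `∫_σ t⁻³ = 3/8 > 0`. (The same collapse happens for every
rank-one `(a b; c d) ≠ 0`, e.g. `a = b = c = d = 1` gives the constant map `g ≡ (1, 0, 0)`.) [folklore] -/
theorem isometryMove_false_without_det : ¬ IsometryMoveWithoutDet := by
  refine gen_false_of_diag 0 1 (by simpa using isAlgebraic_zero) (Or.inl rfl) (fun _ => 0)
    (by funext i; fin_cases i <;> simp [cruxHeight]) (unitBoxRep 3) originRep (unitBoxRep_domain_subset 3)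
    (fun _ _ => rfl) ?_ (fun _ _ => rfl) ?_
  · show (Set.pi univ fun _ => {(0 : ℝ)}) = diagMap (fun _ => 0) '' box _ _
    rw [box, diagMap_image_pi]
    refine pi_eq_pi ?_ ?_ ?_ <;> simp
  · rw [show originRep.value = 0 from value_nullRep _ _ _ _ _]
    exact (value_unitBoxRep_pos 3).ne'

/-- **The `ε`-set `{1, −1}` is exactly right.** For every rational `η ∉ {1, −1}` the `η`-slice is
false. Witness `a = d = 1`, `b = c = 0`, `ε = η`: the typed map is `(x, y, t) ↦ (x, ηy, t)`, which
multiplies the value of the unit box by `|η| ≠ 1` (`η = 0`: collapses it onto a null rectangle). [folklore] -/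
theorem not_isometryMoveAtEps (η : ℚ) (hη1 : η ≠ 1) (hη2 : η ≠ -1) : ¬ IsometryMoveAtEps η := by
  have hI := integral_powInv_pos 3 (zero_lt_one' ℝ) one_lt_two
  rcases lt_trichotomy η 0 with hη | rfl | hη
  · -- η < 0 : image box (0,1) × (η,0) × (1,2), value (-η)·I
    have hηR : (η : ℝ) < 0 := by exact_mod_cast hη
    refine gen_false_of_diag 1 η (by simpa using isAlgebraic_one) ⟨by simp, rfl⟩ ![1, η, 1]
      (by funext i; fin_cases i <;> simp [cruxHeight]) (unitBoxRep 3)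
      (boxRep 3 ![0, η, 1] ![1, 0, 2] (Or.inl (by simp))) (unitBoxRep_domain_subset 3)
      (fun _ _ => rfl) ?_ (fun _ _ => rfl) ?_
    · rw [boxRep_domain, unitBoxRep, boxRep_domain, box, box, diagMap_image_pi]
      refine pi_eq_pi ?_ ?_ ?_ <;> simp [image_mul_left_Ioo_of_neg hηR]
    · rw [value_unitBoxRep,
        value_boxRep 3 _ _ _ (fun i => by fin_cases i <;> simp [hη.le])]
      simp only [Matrix.cons_val_zero, Matrix.cons_val_one, Matrix.head_cons, Matrix.cons_val_two,
        Matrix.tail_cons, Rat.cast_one, Rat.cast_zero, Rat.cast_ofNat, sub_zero, one_mul, zero_sub]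
      intro h
      apply hη2
      have : (-(η : ℝ)) = 1 := (mul_right_cancel₀ hI.ne' (by linarith)).symm
      exact_mod_cast (by linarith : (η : ℝ) = -1)
  · -- η = 0 : image is the null rectangle (0,1) × {0} × (1,2)
    refine gen_false_of_diag 1 0 (by simpa using isAlgebraic_one) ⟨by simp, by simp⟩ ![1, 0, 1]
      (by funext i; fin_cases i <;> simp [cruxHeight]) (unitBoxRep 3)
      (nullRep 3 (Set.pi univ ![Ioo (0 : ℝ) 1, {0}, Ioo 1 2])
        (isSemialgebraic_pi _ fun i => by
          fin_cases i
          · simpa using isSemialgebraic_coord_Ioo 0 0 1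
          · simpa using isSemialgebraic_coord_singleton 1 0
          · simpa using isSemialgebraic_coord_Ioo 2 1 2)
        (isSemialgebraicFunOn_powDensity
          (isSemialgebraic_pi _ fun i => by
            fin_cases i
            · simpa using isSemialgebraic_coord_Ioo 0 0 1
            · simpa using isSemialgebraic_coord_singleton 1 0
            · simpa using isSemialgebraic_coord_Ioo 2 1 2)
          (fun p hp => by
            have h2 : p 2 ∈ Ioo (1 : ℝ) 2 := by simpa using (mem_univ_pi.mp hp) 2
            exact (zero_lt_one.trans h2.1).ne') 3)
        (volume_pi_eq_zero 1 (by simp)))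
      (unitBoxRep_domain_subset 3) (fun _ _ => rfl) ?_ (fun _ _ => rfl) ?_
    · rw [nullRep_domain, unitBoxRep, boxRep_domain, box, diagMap_image_pi]
      refine pi_eq_pi ?_ ?_ ?_ <;> simp
    · rw [value_nullRep]
      exact (value_unitBoxRep_pos 3).ne'
  · -- 0 < η : image box (0,1) × (0,η) × (1,2), value η·I
    have hηR : (0 : ℝ) < η := by exact_mod_cast hη
    refine gen_false_of_diag 1 η (by simpa using isAlgebraic_one) ⟨by simp, rfl⟩ ![1, η, 1]
      (by funext i; fin_cases i <;> simp [cruxHeight]) (unitBoxRep 3)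
      (boxRep 3 ![0, 0, 1] ![1, η, 2] (Or.inl (by simp))) (unitBoxRep_domain_subset 3)
      (fun _ _ => rfl) ?_ (fun _ _ => rfl) ?_
    · rw [boxRep_domain, unitBoxRep, boxRep_domain, box, box, diagMap_image_pi]
      refine pi_eq_pi ?_ ?_ ?_ <;> simp [image_mul_left_Ioo hηR]
    · rw [value_unitBoxRep,
        value_boxRep 3 _ _ _ (fun i => by fin_cases i <;> simp [hη.le])]
      simp only [Matrix.cons_val_zero, Matrix.cons_val_one, Matrix.head_cons, Matrix.cons_val_two,
        Matrix.tail_cons, Rat.cast_one, Rat.cast_zero, Rat.cast_ofNat, sub_zero, one_mul]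
      intro h
      apply hη1
      have : (η : ℝ) = 1 := (mul_right_cancel₀ hI.ne' (by linarith)).symm
      exact_mod_cast this

/-- **`ε = ±1` is load-bearing**: with `ε` unconstrained the statement is false (slice `η = 0`,
or any rational `η ∉ {±1}`, `not_isometryMoveAtEps`). [folklore] -/
theorem isometryMove_false_without_eps : ¬ IsometryMoveWithoutEps :=
  fun h => not_isometryMoveAtEps 0 (by norm_num) (by norm_num) (by simpa using withoutEps_imp_atEps h 0)

end Summit.KontsevichZagierPeriods.HyperbolicBloch.IsometryMoveNegative

end
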